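import Literature.NumberTheory.EllipticCurves.PadicSigmaSqMinusTwist
import Literature.NumberTheory.EllipticCurves.HeegnerPointsOfConductor
import HarnessLib

/-!
# The canonical CYCLOTOMIC `p`-adic height over an ARBITRARY number field `H` (sigma-squared form,
# any splitting behaviour of `p`): the receptacle `PAdicHeightDataK.IsCanonicalCyc`, its existence
# (Mazur–Tate / Schneider / Mazur–Stein–Tate) and its value on the minus part of a quadratic twist

Topic `Literature/NumberTheory/EllipticCurves` (trunk T-NT-EC); sibling of `CanonicalPAdicHeight.lean`
(`PAdicHeightDataK.IsCanonical`, `p` TOTALLY SPLIT in `K`), `PadicSigmaSq.lean` (the squared sigma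
function `Σ_p = σ_p²`, `PAdicHeightDataK.IsCanonicalSq`, again `p` totally split) and
`PadicSigmaSqMinusTwist.lean` (`PAdicHeightData.IsCanonicalSqMinusTwist`: the height of `V/ℚ(√d)` on
the minus part `V^{(d)}(ℚ)`, written through the rational `x`-coordinate; its module docstring ends with
`TODO(general form): a sigma-squared receptacle for points over an arbitrary number field (local terms
log_p N_{K_𝔓/ℚ_p} Σ_p(z_𝔓) at every 𝔓 ∣ p, any splitting behaviour)` — THIS FILE is that general form).
Typer seat `bsd-print-cf2-ty2` (g50) of the cell `bsd-print-cf2` (HOME `run/shared/lean/pub/bsd-print-cf2/`),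
SUMMON `wake/SUMMON-bsd-print-cf2-ty2-20260831T001723Z.md` (planner g25 ENTRY TICKET of the support item
stmt-BirchSwinnertonDyer-27146 `PrintCf2.SplitBadTwoDisegniGZPairOfFacts`, (T1) «the canonicity
predicate `PAdicHeightDataK.IsCanonicalCyc`» and (T2) «restriction functoriality / the PIN to
`IsCanonicalSqMinusTwist`»). BSD is not proved by any of this.

## Why

Disegni's `p`-adic Gross–Zagier formula (Compos. Math. 153 (2017), Theorem B; the cluster
`Disegni2017/`, `ChiLineGrossZagier.lean`) speaks of THE canonical cyclotomic `p`-adic height pairing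
of `A = E/ℚ` on `E(H)` for a number field `H ⊇ K` in which `p` is typically NOT totally split (road (C)
of the cell: `p = 2` RAMIFIED in `H = K(√d*)`), composed with `ℓ = log_p ∘ χ_cyc` and ABSOLUTELY
normalised ([Disegni2017, (4.1.7)]: `ℓ_w := [F′:F]⁻¹ ℓ_v ∘ N_{F′_w/F_v}`). The tree's height data
`PAdicHeightDataK W p H` are ABSTRACT (symmetric, bilinear, torsion-vanishing; the zero pairing is one),
so any `∀ DH`-form of Theorem B needs a predicate pinning `DH`; the tree has one only when `p` is
totally split in the field of the points. This file supplies the general one, in the tree's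
`p`-uniform sigma-SQUARED vocabulary (`Σ_p = σ_p²`, the only object defined at `p = 2`,
[Silverman2005DivPoly, §5 Rem. 2]).

## The mathematics (Mazur–Stein–Tate 2006 §2; held text `paper:anon2006-computation-p-adic-heights-log-convergence`,
## `pN Lk` = PDF page / line of the materialised text)

[MST06 p7 L27–42] for `α, β ∈ E(K)`, `K` a number field, the «universal» height `(α, β) ∈ I(K) =
Γ(K) ⊗ ℚ_p` (idele classes) and, for a linear functional `ρ : I(K) → ℚ_p`, the `ρ`-height
`h_ρ(α) = −½(α,α)_ρ`; [p11 L7–18] for `E/K` GOOD ORDINARY at all `v ∣ p` and `P ∈ E(K)` non-torsion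
«that reduces to `0` in `E(k_v)` for each `v ∣ p`, and to the connected component of all special fibers
of the Néron model»: `h_ρ(P) = Σ_{v∣p} ρ_v(σ_v(P)) − Σ_{w∤p} ρ_w(d_w(P))` («`σ_v` the canonical `p`-adic
σ-function of `E` over `K_v` given in Weierstrass form», `d_w(P)` the local denominator; «`h_ρ` is
quadratic because of property IV of `σ` in [MT91]»); [p11 L33–58] the CYCLOTOMIC functional of `K` is
`ρ^K_cycl := ρ^ℚ_cycl ∘ N_{K/ℚ}` and
`h_p(P) = p⁻¹ · [ Σ_{v∣p} log_p N_{K_v/ℚ_p}(σ_v(P)) − Σ_{w∤p} ord_w(d_w(P)) · log_p #k_w ]`.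
In the tree's Stein–Wuthrich / sigma-squared normalisation (`canonicalPAdicHeightSq`: `log_p den x −
log_p Σ_p(z)`, `= −2p ×` MST's `h_p`; `log_p N𝔡(x) = 2 Σ_w ord_w(d_w) log_p #k_w`, the `w ∣ p` summands
vanishing as `log_p p = 0`) this is, for `E = W ⊗ H` (`W/ℚ`), `P = (x, y) ∈ E(H)`, `z = −x/y`:

  `ĥ_{p,H}(P) = log_p N(𝔡_H(x)) − Σ_{w∣p} log_p N_{H_w/ℚ_p} Σ_p(z)`   (un-normalised: a sum over the places of `H`).

THE `p`-PART WITHOUT COMPLETIONS (the one observation of this file). `Σ_p ∈ t² + t³ℤ_p⟦t⟧` has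
`ℚ_p`-coefficients, so with `S := Σ_p/t² = 1 + a₁t + ⋯` and `ℒ := log S ∈ ℚ_p⟦t⟧` (`ℒ(0) = 0`,
`dℒ = dS/S`; `padicLogSigmaSqShift`): for every embedding `τ : H → ℚ̄_p`,
`log_p Σ_p(τz) = 2 log_p(τz) + ℒ(τz)`, and the embeddings above a place `w` realise `N_{H_w/ℚ_p}`;
summing over all `[H:ℚ]` embeddings,

  `Σ_{w∣p} log_p N_{H_w/ℚ_p} Σ_p(z) = 2·log_p N_{H/ℚ}(z) + Σ_{n≥1} ℒ_n · Tr_{H/ℚ}(zⁿ)`   (`sigmaSqNormLog`),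

an element of `ℚ_p` written with the RATIONAL numbers `N_{H/ℚ}(z)`, `Tr_{H/ℚ}(zⁿ)` (Mathlib
`Algebra.norm ℚ`, `Algebra.trace ℚ H`) and the tree's Iwasawa logarithm `padicLog` on `ℚ_p` — no
`p`-adic completion of `H`, no extension of `log_p` beyond `ℚ_p` is needed (the series converges because
every `|z|_w < 1`). For `H = ℚ` this is `log_p Σ_p(z)` (`log_p(z²S(z))`), for `p` totally split in `K`
it is the tree's `Σ_{ι : K → ℚ_p} log_p Σ_p(z(ιP))` (`canonicalPAdicHeightSqK`).

ADMISSIBILITY (`IsAdmissibleCyc` = non-torsion ∧ `SatisfiesLocalConditionsCyc`), place by place through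
Mathlib's `HeightOneSpectrum.valuation` (no embeddings either): at every `w ∣ p`, `ord_w x < 0`
(`P ∈ E₁(H_w)`: MST «reduces to `0` in `E(k_v)`») AND `z` in the sigma disc `ord_p z > 1/(p−1)`
([SteinWuthrich2013, §4]; as `ord_w(z^{p−1}) > ord_w(p)`); at every finite `v`, non-singular reduction
of `(x,y)` on `W ⊗ H` (the tree's `HasNonsingularReductionAtK`: MST «connected component of all special
fibers»). MEANINGFUL FOR `W ⊗ H` GLOBALLY MINIMAL (the denominator term is the local height only on a
model minimal at `v`; [MST06 p8 L42] «some minimal Weierstrass model at `v`»), exactly as the tree's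
`IsCanonical` / `IsCanonicalSq` over `K`; the existence fact below carries this hypothesis.

NORMALISATION OF THE PREDICATE — ABSOLUTE: `IsCanonicalCyc DH :↔ ∀ P admissible,
⟨P,P⟩_{DH} = [H:ℚ]⁻¹ · ĥ_{p,H}(P)`. This is Disegni's (4.1.7)–(4.1.8) convention (the pairing on
`A(F̄)` restricts to each `A(F′)` compatibly with RESTRICTION, so a point of `E(ℚ)` has the same height
in every `H`: the cluster's `PAdicHeightDataK.RestrictsToWith D 1`), and Yuan–Zhang–Zhang's on the
archimedean side ([YuanZhangZhang2013, §7.1.1]); it differs from the tree's UN-normalised `K`-predicates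
`IsCanonical` / `IsCanonicalSq` («sum over the places of `K`», `RestrictsTo` = factor `[K:ℚ]`) by the
factor `[H:ℚ]`, kept visible in `canonicalPAdicHeightCyc` (un-normalised) vs. the predicate. With this
convention the comparison with the minus-twist receptacle has factor ONE
(`isCanonicalCyc_pairing_eq_minusTwist`: `[H:ℚ]⁻¹·[H:ℚ(√d)]·h_{V/ℚ(√d)}(P′) = ½ h_{V/ℚ(√d)}(P′)`, which
is `canonicalPAdicHeightSqMinusTwist` by its defining convention).

## What is here

* DEFINITIONS WITH BODIES: `padicLogSigmaSqShift`, `SatisfiesLocalConditionsCyc`, `IsAdmissibleCyc`,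
  `sigmaSqNormLog`, `canonicalPAdicHeightCyc`, `PAdicHeightDataK.IsCanonicalCyc`, `PAdicHeightDataK.smul`
  (rescaling a datum by `c ∈ ℚ`, for facts that pin a datum only up to a universal constant), with
  unfolding API; PROVED: `PAdicHeightDataK.isCanonicalCyc_unique` (two canonical data coincide, given
  admissible multiples — the tree's `ext_of_sq_eq_on`).
* NAMED FACT `exists_isCanonicalCyc` (+1): existence of THE canonical cyclotomic height datum on `E(H)`
  — symmetric bilinear, torsion-vanishing, `Aut(H/ℚ)`-invariant, with the sigma-squared quadratic form
  on admissible points — for `W ⊗ H` globally minimal and `p` GOOD ORDINARY (any `p`, `p = 2` included,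
  where it is the `σ²`-statement of [Silverman2005DivPoly, §5 Rem. 2] / [MazurTate1991, Thm. 3.1]).
* NAMED FACT `isCanonicalCyc_pairing_eq_minusTwist` (+1): the value of the canonical `H`-datum on an
  `H`-point `P′` of `V` with `x(P′) = X/d` equals the minus-twist receptacle's value on
  `P = (X,Y) ∈ V^{(d)}(ℚ)` — restriction functoriality `H ⊇ ℚ(√d) ⊇ ℚ` ([MST06 §2.8]
  `ρ^K_cycl = ρ^ℚ_cycl ∘ N`; [Disegni2017, (4.1.7)–(4.1.8)]) + the norm computation of
  `PadicSigmaSqMinusTwist.lean` (`N Σ_p(z) = Σ_p(z)Σ_p(i z) = 𝔖_p(1/x)²`).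

## What is NOT here

No proof that the two facts hold (each is size L: the analytic identity `𝔖_p(1/x(z)) = Σ_p(z)` as
convergent series in a ramified quadratic extension of `ℚ_p`, Mazur–Tate's Thm. 3.1 at `p = 2`,
admissible multiples over `H`); no `RestrictsToWith`-lemma for `ℚ`-points (a special case of the
second fact's mechanism, not needed by the cell); no identification with `IsCanonicalSq` for `p` totally
split (same values, un-normalised vs absolute: `TODO`); no statement for `W ⊗ H` non-minimal (there the
predicate is not satisfied by the canonical height and the facts are silent / vacuous).
`-- TODO(general form): curves over a number field F (not base-changed from ℚ); the anticyclotomic and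
-- general ρ-heights of MST06 §2.1 (replace N_{H/ℚ}, Tr_{H/ℚ} by the ρ_v); multiplicative reduction at p.`

## References

* [MazurSteinTate2006] B. Mazur, W. Stein, J. Tate, *Computation of p-adic heights and log convergence*,
  Doc. Math. Extra Vol. Coates (2006) 577–614: §2.1 (PDF p. 7 L11–52), §2.2–2.4 (p. 8), §2.6–2.7
  (pp. 10–11: `h_ρ(P) = Σ_{v∣p} ρ_v(σ_v(P)) − Σ_{w∤p} ρ_w(d_w(P))`), §2.8 (p. 11 L23–47: `ρ^K_cycl =
  ρ^ℚ_cycl ∘ N_{K/ℚ}`, the displayed formula for `h_p(P)`), §1 eq. (1.1), Thm. 1.3.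
* [MazurTate1991] B. Mazur, J. Tate, *The p-adic sigma function*, Duke Math. J. 62 (1991), Thm. 3.1,
  properties III–IV (through MST06 and Silverman 2005; not held).
* [Silverman2005DivPoly] J. H. Silverman, Math. Ann. 332 (2005), §5 Thm. 11 and Rem. 2 (`σ²` at `p = 2`).
* [Schneider1982] P. Schneider, *p-adic height pairings I*, Invent. Math. 69 (1982), §1 (norm-adapted
  height, ordinary reduction at the places above `p` of any number field); [MazurTateTeitelbaum1986Invent]
  §II.4–5; [PerrinRiou1987] §1.2; [IovitaWerner2003] (Mazur–Tate = Schneider = Nekovář heights).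
* [Disegni2017] D. Disegni, Compos. Math. 153 (2017) = arXiv:1510.02114v3: §1.3.1 (PDF p. 7 L30–48:
  the canonical pairing (1.3.1) and its Galois equivariance), §4.1.1 (4.1.7)–(4.1.8) (PDF p. 28
  L97–103, p. 29 L1–5: `ℓ_w := [F′:F]⁻¹ ℓ_v ∘ N`, compatibility with restriction).
* [BalakrishnanCiperianiStein2015] Math. Comp. 84 (2015), §4.1 eq. (4.1) (the same number-field formula;
  not held, cited through MST06).
* [SteinWuthrich2013] Math. Comp. 82 (2013), §4, §4.1 eq. (4.1) (normalisation, sigma disc).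
* Cell: `wake/SUMMON-bsd-print-cf2-ty2-20260831T001723Z.md` (T1)/(T2); `Theses/PrintCf2.lean` item
  stmt-27146; `bsd-print-cf2-ref/PREGRADE-disegni-pair-two-v3-ref-g27.md` item 4 and N2.
-/

noncomputable section

open scoped Classical
open PowerSeries NumberField IsDedekindDomain Literature.NumberTheory.EllipticCurves

namespace WeierstrassCurve

/-! ### §1 `ℒ = log(Σ_p/t²)` over `ℚ_p` -/

section Padic

variable {p : ℕ} [Fact p.Prime] (W : WeierstrassCurve ℚ_[p])

/-- **`ℒ_p = log(Σ_p(t)/t²) ∈ ℚ_p⟦t⟧`**: with `S := Σ_p/t² = 1 + a₁t + ⋯` (`sigmaShift` twice of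
`padicSigmaSq`; `[t²]Σ_p = 1`, `[t³]Σ_p = a₁`), the series with `ℒ(0) = 0` and `dℒ/dt = S′/S`, i.e.
`[tⁿ]ℒ = n⁻¹ · [tⁿ⁻¹](S′·S⁻¹)` for `n ≥ 1` (`S⁻¹ = invOfUnit S 1`, correct when `S(0) = 1`). So
`log_p Σ_p(u) = 2 log_p u + ℒ(u)` for `u` in the sigma disc of any `p`-adic field (coefficient
denominators of `ℒ` grow at most like `n`). Junk when `Σ_p` is junk.
[cite: MazurSteinTate2006, §2.7 (PDF p. 11 L7–18: «σ_v the canonical p-adic σ-function of E over K_v … h_ρ(P) = Σ_{v∣p} ρ_v(σ_v(P)) − …»)]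
[cite: Silverman2005DivPoly, §5 Rem. 2] -/
def padicLogSigmaSqShift : ℚ_[p]⟦X⟧ :=
  let S : ℚ_[p]⟦X⟧ := sigmaShift (sigmaShift W.padicSigmaSq)
  PowerSeries.mk fun n =>
    if n = 0 then 0 else (coeff (n - 1) (d⁄dX ℚ_[p] S * S.invOfUnit 1)) / (n : ℚ_[p])

/-- `ℒ(0) = 0`. [cite: MazurSteinTate2006, §2.7] -/
@[simp] theorem constantCoeff_padicLogSigmaSqShift : constantCoeff W.padicLogSigmaSqShift = 0 := by
  rw [← coeff_zero_eq_constantCoeff_apply, padicLogSigmaSqShift, coeff_mk, if_pos rfl]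

/-- The coefficients of `ℒ` for `n ≥ 1`: `[tⁿ]ℒ = n⁻¹ [tⁿ⁻¹](S′ S⁻¹)`, `S = Σ_p/t²`.
[cite: MazurSteinTate2006, §2.7] -/
theorem coeff_padicLogSigmaSqShift_of_ne_zero {n : ℕ} (hn : n ≠ 0) :
    coeff n W.padicLogSigmaSqShift =
      (coeff (n - 1) (d⁄dX ℚ_[p] (sigmaShift (sigmaShift W.padicSigmaSq)) *
          (sigmaShift (sigmaShift W.padicSigmaSq)).invOfUnit 1)) / (n : ℚ_[p]) := by
  rw [padicLogSigmaSqShift, coeff_mk, if_neg hn]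

end Padic

/-! ### §2 Over a number field `H`: admissibility, the un-normalised height, the predicate -/

section NumberField

variable (W : WeierstrassCurve ℚ) (p : ℕ) [Fact p.Prime] (H : Type) [Field H] [NumberField H]

/-- **Local conditions on `P = (x, y) ∈ E(H)`, at every place** (no `p`-adic completion is formed; all
through `HeightOneSpectrum.valuation`): at each `w ∣ p`, `ord_w x < 0` (`P` reduces to `0`, i.e. lies in
`E₁(H_w)`) and `z = −x/y` is in the sigma disc `ord_p z > 1/(p−1)` (⟺ `ord_w(z^{p−1}) > ord_w(p)`; at
`p = 2`: `ord_w z > ord_w 2`); at every finite place `v`, non-singular reduction of `(x, y)` on the model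
`W ⊗ H` (`HasNonsingularReductionAtK`). Parallel to `SatisfiesLocalConditionsK` (which asks the first
condition through the embeddings `K → ℚ_p`, available only for `p` totally split).
[cite: MazurSteinTate2006, §2.7 (PDF p. 10 L71 – p. 11 L6: «reduces to 0 in E(k_v) for each v ∣ p, and to the connected component of all special fibers»)]
[cite: SteinWuthrich2013, §4 (sigma disc ord_p t > 1/(p−1))] -/
def SatisfiesLocalConditionsCyc : (W.baseChange H).toAffine.Point → Prop
  | .zero => False
  | .some x y _ =>
      (∀ w : HeightOneSpectrum (𝓞 H), ((p : ℕ) : 𝓞 H) ∈ w.asIdeal →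
          1 < w.valuation H x ∧ w.valuation H ((-x / y) ^ (p - 1)) < w.valuation H (p : H)) ∧
        ∀ v : HeightOneSpectrum (𝓞 H), W.HasNonsingularReductionAtK H v x y

/-- **Admissible points of `E(H)`**: non-torsion and satisfying the local conditions (a consumer
replaces `P` by a multiple `mP`; heights scale by `m²`). [cite: MazurSteinTate2006, §2.6 (PDF p. 10 L7–17: «replacing α, β by m·α, n·β …») and §2.7] -/
def IsAdmissibleCyc (P : (W.baseChange H).toAffine.Point) : Prop :=
  ¬ IsOfFinAddOrder P ∧ W.SatisfiesLocalConditionsCyc p H P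

/-- **`Σ_{w∣p} log_p N_{H_w/ℚ_p} Σ_p(z_w)` for `z ∈ H`, written inside `ℚ_p`**:
`2 · log_p N_{H/ℚ}(z) + Σ'_{n} [tⁿ]ℒ_p · Tr_{H/ℚ}(zⁿ)` (`ℒ_p = padicLogSigmaSqShift` of `W ⊗ ℚ_p`; the
`n = 0` summand is `0`). DERIVATION: over `ℚ̄_p`, `log_p Σ_p(τz) = 2 log_p τz + ℒ(τz)` for each of the
`[H:ℚ]` embeddings `τ`, which are grouped by the places `w ∣ p` into the local norms/traces;
`Π_τ τz = N_{H/ℚ}(z)` and `Σ_τ (τz)ⁿ = Tr_{H/ℚ}(zⁿ)` are RATIONAL, and `log_p` is the Iwasawa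
logarithm (`padicLog`). Convergent when every `|z|_w`, `w ∣ p`, is in the sigma disc; `tsum` junk
otherwise. [cite: MazurSteinTate2006, §2.8 (PDF p. 11 L33–58: ρ^K_cycl = ρ^ℚ_cycl ∘ N_{K/ℚ}; h_p(P) = p⁻¹[Σ_{v∣p} log_p N_{K_v/ℚ_p} σ_v(P) − Σ_{w∤p} ord_w(d_w(P)) log_p #k_w])] -/
def sigmaSqNormLog (z : H) : ℚ_[p] :=
  2 * padicLog p (algebraMap ℚ ℚ_[p] (Algebra.norm ℚ z)) +
    ∑' n : ℕ, coeff n (W.baseChange ℚ_[p]).padicLogSigmaSqShift *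
      algebraMap ℚ ℚ_[p] (Algebra.trace ℚ H (z ^ n))

/-- **The canonical cyclotomic `p`-adic height over `H` of an admissible point, UN-normalised**
(a sum over the places of `H`; sigma-squared / Stein–Wuthrich normalisation, `= −2p ×` MST's `h_p`):
`ĥ_{p,H}(P) = log_p N(𝔡_H(x)) − Σ_{w∣p} log_p N_{H_w/ℚ_p} Σ_p(−x/y)` with the `p`-part in the closed
form `sigmaSqNormLog` (`denominatorIdeal` = `𝔡(x) = {r ∈ 𝓞_H ∣ r·x ∈ 𝓞_H} = 𝔢²`, so `log_p N𝔡 =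
2Σ_{v∤p} ord_v(𝔢) log_p Nv`, the `v ∣ p` part vanishing since `log_p p = 0`). For `H = ℚ` resp. `p`
totally split in `K` these are the values of `canonicalPAdicHeightSq` resp. `canonicalPAdicHeightSqK`.
Junk off the admissible locus and for `W ⊗ H` not minimal; `0` at `O`.
[cite: MazurSteinTate2006, §2.7–2.8 (PDF p. 11 L7–58)] [cite: BalakrishnanCiperianiStein2015, §4.1 eq. (4.1)]
[cite: Silverman2005DivPoly, §5 Rem. 2] -/
def canonicalPAdicHeightCyc : (W.baseChange H).toAffine.Point → ℚ_[p]
  | .zero => 0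
  | .some x y _ =>
      padicLog p ((Ideal.absNorm (denominatorIdeal H x) : ℚ) : ℚ_[p]) - W.sigmaSqNormLog p H (-x / y)

variable {W p H} in
/-- **`DH` is THE canonical cyclotomic `p`-adic height pairing on `E(H)`, ABSOLUTELY normalised**
(Disegni's (1.3.1) composed with `ℓ = log_p ∘ χ_cyc` and extended to `A(F̄)` by (4.1.7)–(4.1.8);
Schneider's norm-adapted / Mazur–Tate's canonical height for the cyclotomic `ℤ_p`-extension, divided by
`[H:ℚ]`): on every admissible point, `⟨P, P⟩_{DH} = [H:ℚ]⁻¹ · ĥ_{p,H}(P)` (`canonicalPAdicHeightCyc`).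
`H` arbitrary (any splitting of `p`), `p` any prime (`p = 2` included: sigma-SQUARED form). Determines
`DH` given admissible multiples (`isCanonicalCyc_unique`). Meaningful for `W ⊗ H` globally minimal and
`p` good ordinary; nothing is asserted here (existence: `exists_isCanonicalCyc`). CAVEAT (as for
`IsCanonicalSq`): that the sigma(-squared) formula IS the Schneider / Mazur–Tate / Nekovář height is the
content of [MST06 §2.7] («σ_v the canonical p-adic σ-function», [MT91] property IV) and
[IovitaWerner2003] / [Disegni2017, §1.3.1 p. 7 L48]; a universal normalising constant between an
author's `ℓ`-pairing and this Stein–Wuthrich form is for each consumer fact to carry.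
[cite: MazurSteinTate2006, §2.7–2.8 (PDF p. 11 L7–58)] [cite: Disegni2017, §4.1.1 (4.1.7)–(4.1.8) (arXiv v3 PDF p. 28 L97 – p. 29 L5)]
[cite: Silverman2005DivPoly, §5 Rem. 2] -/
def PAdicHeightDataK.IsCanonicalCyc (DH : PAdicHeightDataK W p H) : Prop :=
  ∀ P : (W.baseChange H).toAffine.Point, W.IsAdmissibleCyc p H P →
    DH.pairing P P = ((Module.finrank ℚ H : ℕ) : ℚ_[p])⁻¹ * W.canonicalPAdicHeightCyc p H P

variable {W p H} in
/-- **Rescaling a height datum by a rational constant** `c`: `⟨P, Q⟩_{c•D} = c · ⟨P, Q⟩_D` (again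
symmetric, bilinear, torsion-vanishing). Used by facts that identify an author's canonical pairing with
the tree's receptacle only up to a universal constant. A plain definition (no `SMul` instance).
[cite: MazurSteinTate2006, §2.1 (PDF p. 7 L38–42: «the ρ-height pairing is a normalization of the cyclotomic height pairing»)] -/
def PAdicHeightDataK.smul (c : ℚ) (DH : PAdicHeightDataK W p H) : PAdicHeightDataK W p H where
  pairing :=
    { toFun := fun P => (c : ℚ_[p]) • DH.pairing P
      map_zero' := by simp
      map_add' := fun P Q => by simp [smul_add] }
  symm P Q := by
    simp only [AddMonoidHom.coe_mk, ZeroHom.coe_mk, AddMonoidHom.smul_apply, DH.symm P Q]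
  map_torsion P Q hP := by
    simp only [AddMonoidHom.coe_mk, ZeroHom.coe_mk, AddMonoidHom.smul_apply, DH.map_torsion P Q hP,
      smul_zero]

/-! #### API -/

omit [Fact p.Prime] in
/-- The point at infinity satisfies no local condition. [cite: MazurSteinTate2006, §2.7] -/
@[simp] theorem not_satisfiesLocalConditionsCyc_zero : ¬ W.SatisfiesLocalConditionsCyc p H 0 :=
  fun h => h

omit [Fact p.Prime] in
/-- `O` is not admissible. [cite: MazurSteinTate2006, §2.7] -/
@[simp] theorem not_isAdmissibleCyc_zero : ¬ W.IsAdmissibleCyc p H 0 := fun h => h.2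

variable {W p H} in
omit [Fact p.Prime] in
/-- Unfolding the local conditions on an affine point. [cite: MazurSteinTate2006, §2.7 (PDF p. 10 L71 – p. 11 L6)] -/
theorem satisfiesLocalConditionsCyc_some {x y : H} (h : (W.baseChange H).toAffine.Nonsingular x y) :
    W.SatisfiesLocalConditionsCyc p H (.some x y h) ↔
      (∀ w : HeightOneSpectrum (𝓞 H), ((p : ℕ) : 𝓞 H) ∈ w.asIdeal →
          1 < w.valuation H x ∧ w.valuation H ((-x / y) ^ (p - 1)) < w.valuation H (p : H)) ∧
        ∀ v : HeightOneSpectrum (𝓞 H), W.HasNonsingularReductionAtK H v x y :=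
  Iff.rfl

variable {W p H} in
omit [Fact p.Prime] in
/-- An admissible point is not torsion. [cite: MazurSteinTate2006, §2.7] -/
theorem IsAdmissibleCyc.not_isOfFinAddOrder {P : (W.baseChange H).toAffine.Point}
    (hP : W.IsAdmissibleCyc p H P) : ¬ IsOfFinAddOrder P :=
  hP.1

/-- `ĥ_{p,H}(O) = 0` (the tree's convention at `O`). [cite: MazurSteinTate2006, §2.7] -/
@[simp] theorem canonicalPAdicHeightCyc_zero : W.canonicalPAdicHeightCyc p H 0 = 0 := rfl

variable {W p H} in
/-- Unfolding on an affine point: `log_p N𝔡(x) − [2 log_p N_{H/ℚ}(z) + Σ' ℒ_n Tr_{H/ℚ}(zⁿ)]`, `z = −x/y`.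
[cite: MazurSteinTate2006, §2.7–2.8 (PDF p. 11)] -/
theorem canonicalPAdicHeightCyc_some {x y : H} (h : (W.baseChange H).toAffine.Nonsingular x y) :
    W.canonicalPAdicHeightCyc p H (.some x y h) =
      padicLog p ((Ideal.absNorm (denominatorIdeal H x) : ℚ) : ℚ_[p]) -
        W.sigmaSqNormLog p H (-x / y) := rfl

/-- Unfolding `sigmaSqNormLog`. [cite: MazurSteinTate2006, §2.8 (PDF p. 11 L33–58)] -/
theorem sigmaSqNormLog_def (z : H) :
    W.sigmaSqNormLog p H z =
      2 * padicLog p (algebraMap ℚ ℚ_[p] (Algebra.norm ℚ z)) +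
        ∑' n : ℕ, coeff n (W.baseChange ℚ_[p]).padicLogSigmaSqShift *
          algebraMap ℚ ℚ_[p] (Algebra.trace ℚ H (z ^ n)) := rfl

variable {W p H}

/-- Unfolding `IsCanonicalCyc` at an admissible point. [cite: MazurSteinTate2006, §2.7–2.8] -/
theorem PAdicHeightDataK.IsCanonicalCyc.pairing_self_eq {DH : PAdicHeightDataK W p H}
    (hD : DH.IsCanonicalCyc) {P : (W.baseChange H).toAffine.Point} (hP : W.IsAdmissibleCyc p H P) :
    DH.pairing P P = ((Module.finrank ℚ H : ℕ) : ℚ_[p])⁻¹ * W.canonicalPAdicHeightCyc p H P :=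
  hD P hP

/-- The un-normalised value: `[H:ℚ] · ⟨P,P⟩_{DH} = ĥ_{p,H}(P)` on admissible points (the tree's
`RestrictsTo`-convention value). [cite: Disegni2017, §4.1.1 (4.1.7) (arXiv v3 PDF p. 28 L97–101)] -/
theorem PAdicHeightDataK.IsCanonicalCyc.finrank_mul_pairing_self_eq {DH : PAdicHeightDataK W p H}
    (hD : DH.IsCanonicalCyc) {P : (W.baseChange H).toAffine.Point} (hP : W.IsAdmissibleCyc p H P) :
    ((Module.finrank ℚ H : ℕ) : ℚ_[p]) * DH.pairing P P = W.canonicalPAdicHeightCyc p H P := by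
  have hne : ((Module.finrank ℚ H : ℕ) : ℚ_[p]) ≠ 0 := by
    exact_mod_cast (Module.finrank_pos (R := ℚ) (M := H)).ne'
  rw [hD P hP, ← mul_assoc, mul_inv_cancel₀ hne, one_mul]

/-- `⟨P, Q⟩_{c•D} = c · ⟨P, Q⟩_D`. [cite: MazurSteinTate2006, §2.1 (PDF p. 7 L38–42)] -/
@[simp] theorem PAdicHeightDataK.smul_pairing (c : ℚ) (DH : PAdicHeightDataK W p H)
    (P Q : (W.baseChange H).toAffine.Point) :
    (DH.smul c).pairing P Q = (c : ℚ_[p]) * DH.pairing P Q := by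
  simp only [PAdicHeightDataK.smul, AddMonoidHom.coe_mk, ZeroHom.coe_mk, AddMonoidHom.smul_apply,
    smul_eq_mul]

/-- Rescaling by `1` does nothing. [cite: MazurSteinTate2006, §2.1] -/
theorem PAdicHeightDataK.smul_one (DH : PAdicHeightDataK W p H) : DH.smul 1 = DH := by
  cases DH with
  | mk pairing symm map_torsion =>
    simp only [PAdicHeightDataK.smul, PAdicHeightDataK.mk.injEq]
    ext P Q
    simp

/-- Rescaling is compatible with any group of operators acting through the points: if `⟨σa, σb⟩_D =
⟨a, b⟩_D` then the same holds for `c • D`. [cite: Disegni2017, §1.3.1 (arXiv v3 PDF p. 7 L38: «Its equivariance properties under the action of 𝒢_F»)] -/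
theorem PAdicHeightDataK.smul_pairing_invariant (c : ℚ) {DH : PAdicHeightDataK W p H}
    {φ : (W.baseChange H).toAffine.Point → (W.baseChange H).toAffine.Point}
    (h : ∀ a b, DH.pairing (φ a) (φ b) = DH.pairing a b) (a b : (W.baseChange H).toAffine.Point) :
    (DH.smul c).pairing (φ a) (φ b) = (DH.smul c).pairing a b := by
  rw [PAdicHeightDataK.smul_pairing, PAdicHeightDataK.smul_pairing, h a b]

/-! #### Uniqueness of the canonical datum (given admissible multiples) -/

/-- **Two canonical cyclotomic data on `E(H)` coincide**, provided every non-torsion point has an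
admissible multiple (scale by `m²`, polarise: the tree's `PAdicHeightDataK.ext_of_sq_eq_on`).
[cite: MazurSteinTate2006, §2.6 (PDF p. 10 L10–17: «replacing α, β by m·α, n·β … (α, β) = (mn)⁻¹(m·α, n·β)»)] -/
theorem PAdicHeightDataK.isCanonicalCyc_unique {D₁ D₂ : PAdicHeightDataK W p H}
    (hS : ∀ P : (W.baseChange H).toAffine.Point, ¬ IsOfFinAddOrder P →
      ∃ m : ℕ, m ≠ 0 ∧ W.IsAdmissibleCyc p H (m • P))
    (h₁ : D₁.IsCanonicalCyc) (h₂ : D₂.IsCanonicalCyc) : D₁ = D₂ :=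
  PAdicHeightDataK.ext_of_sq_eq_on {P | W.IsAdmissibleCyc p H P} hS fun Q hQ => by
    rw [h₁ Q hQ, h₂ Q hQ]

end NumberField

/-! ### §3 Named facts (nothing asserted) -/

/-- **Existence (and Galois invariance) of THE canonical cyclotomic `p`-adic height over a number
field** (Schneider 1982 §1 / Mazur–Tate 1983; sigma formula: Mazur–Tate 1991 Thm. 3.1 property IV,
Mazur–Stein–Tate 2006 §2.7–2.8; `σ²` at `p = 2`: Silverman 2005 §5 Rem. 2): for `E/ℚ` with Weierstrass
model `W` such that `W ⊗ H` is GLOBALLY MINIMAL over the number field `H`, and a prime `p` of GOOD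
ORDINARY reduction (`p ∤ a_p`; hence good ordinary at every place of `H` above `p`), there is a
symmetric bilinear torsion-vanishing pairing `DH` on `E(H)` which (i) is canonical in the sense of
`IsCanonicalCyc` — on every admissible `P`, `[H:ℚ]·⟨P,P⟩ = log_p N𝔡(x) − Σ_{w∣p} log_p N_{H_w/ℚ_p} Σ_p(z)`
(MST06 (2.8) with `ρ^H_cycl = ρ^ℚ_cycl ∘ N_{H/ℚ}`, «`h_ρ` is quadratic because of property IV of σ»,
×`(−2p)` and squared) — and (ii) is invariant under `Aut(H/ℚ)` acting on `E(H)` (`pointGalHom`; the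
pairing of [Disegni2017, (1.3.1)] is `𝒢_ℚ`-equivariant and `ρ_cycl` is `Aut(H/ℚ)`-invariant; on
admissible points this is visible on the formula: `N𝔡`, `N_{H/ℚ}`, `Tr_{H/ℚ}` are Galois-invariant).
ANY `p`, `p = 2` included. Nothing is asserted; no `_holds` (size L: Mazur–Tate's construction of `σ`,
quadraticity, admissible multiples). [cite: MazurSteinTate2006, §2.1 (PDF p. 7 L27–42), §2.7–2.8 (PDF p. 11 L7–58)]
[cite: Silverman2005DivPoly, §5 Thm. 11 and Rem. 2] [cite: Disegni2017, §1.3.1 (arXiv v3 PDF p. 7 L30–38)]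
[cite: Schneider1982, §1] -/
def exists_isCanonicalCyc : Prop :=
  ∀ (W : WeierstrassCurve ℚ) [W.IsElliptic] [W.IsGloballyMinimal] (p : ℕ) [Fact p.Prime] (H : Type)
    [Field H] [NumberField H] [(W.baseChange H).IsGloballyMinimal],
    W.HasGoodReductionAtPrime p → ¬ (p : ℤ) ∣ W.frobeniusTrace p →
      ∃ DH : PAdicHeightDataK W p H, DH.IsCanonicalCyc ∧
        ∀ (σ : H ≃ₐ[ℚ] H) (a b : (W.baseChange H).toAffine.Point),
          DH.pairing (pointGalHom W H σ a) (pointGalHom W H σ b) = DH.pairing a b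

/-- **The canonical `H`-datum evaluated on the minus part of a quadratic twist equals the minus-twist
receptacle** (restriction functoriality `H ⊇ ℚ(√d) ⊇ ℚ` of the cyclotomic height — MST06 §2.8
`ρ^K_cycl = ρ^ℚ_cycl ∘ N_{K/ℚ}`, so the UN-normalised height of a point defined over a subfield `F′`
acquires the factor `[H:F′]`; Disegni (4.1.7)–(4.1.8): the absolutely normalised pairings are compatible
with restriction — combined with the norm computation of `PadicSigmaSqMinusTwist.lean`: for `P′ ∈ V(F′)`,
`F′ = ℚ(√d)`, with `conj P′ = −P′` and rational `x(P′) = X/d`, `N_{F′_𝔓/ℚ_p} Σ_p(z) = Σ_p(z)Σ_p(i(z)) =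
𝔖_p(1/x(P′))²`, whence `[H:ℚ]⁻¹ · ĥ_{p,H}(P′) = ½ ĥ_{p,F′}(P′) = log_p den(X/d) − log_p 𝔖_p(d/X) =
canonicalPAdicHeightSqMinusTwist V p d P`): for `V/ℚ` elliptic, a prime `p`, `d ∈ ℚ` with `V^{(d)}`
elliptic, a number field `H`, a datum `DH` on `V(H)` with `IsCanonicalCyc` and a datum `Dc` on
`V^{(d)}(ℚ)` with `IsCanonicalSqMinusTwist`: for every `P = (X, Y) ∈ V^{(d)}(ℚ)` and every `H`-point
`P′` of `V` with `x(P′) = X/d` (these are `±` the point `(X/d, (Y/d²)√d − (a₁X/d + a₃)/2)`, so `√d ∈ H`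
as soon as `P` is not `2`-torsion), `⟨P′, P′⟩_{DH} = ⟨P, P⟩_{Dc}` — factor ONE in the absolute
normalisation. Stated for ALL `P` (both sides are quadratic forms in `P` killing torsion, equal on
admissible points, and admissible multiples exist on either side); where either predicate is not
satisfiable (non-minimal models) the statement is vacuous. Nothing is asserted; no `_holds` (size L: the
identity `𝔖_p(1/x(z)) = Σ_p(z)` of convergent series in a quadratic extension of `ℚ_p`, admissible
multiples). [cite: MazurSteinTate2006, §2.8 (PDF p. 11 L33–47: ρ^K_cycl := ρ^ℚ_cycl ∘ N_{K/ℚ})]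
[cite: Disegni2017, §4.1.1 (4.1.7)–(4.1.8) (arXiv v3 PDF p. 28 L97 – p. 29 L5)]
[cite: Silverman2005DivPoly, §5 Rem. 2] [cite: BalakrishnanCiperianiStein2015, §4.1 eq. (4.1)] -/
def isCanonicalCyc_pairing_eq_minusTwist : Prop :=
  ∀ (V : WeierstrassCurve ℚ) [V.IsElliptic] (p : ℕ) [Fact p.Prime] (d : ℚ)
    [(V.quadraticTwist d).IsElliptic] (H : Type) [Field H] [NumberField H]
    (DH : PAdicHeightDataK V p H) (Dc : PAdicHeightData (V.quadraticTwist d) p),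
    DH.IsCanonicalCyc → Dc.IsCanonicalSqMinusTwist →
      ∀ {X Y : ℚ} (hP : (V.quadraticTwist d).toAffine.Nonsingular X Y) {x' y' : H}
        (hP' : (V.baseChange H).toAffine.Nonsingular x' y'),
        x' = algebraMap ℚ H (X / d) →
          DH.pairing (.some x' y' hP') (.some x' y' hP') = Dc.pairing (.some X Y hP) (.some X Y hP)

end WeierstrassCurve

end
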